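import Summits.AtomisticToContinuum.HydrodynamicLimit.Theorems.CollisionIsometryCLTAdaptedWeightCLTTLPastDampingKernel
import Summits.AtomisticToContinuum.HydrodynamicLimit.Theorems.CollisionIsometryCLTAdaptedWeightCLTTLColumnDepolarisationRate
import Literature.Analysis.FluidPDE.HardSphereFlowGroup

/-!
# Stub `stub_pastDamping` of the line `contact-source-duhamel` — helper file: the SCALES of the
PAST estimate (crux `CollisionIsometryCLT.AdaptedWeightCLT`, stmt-AtomisticToContinuum-14868,
`--supports`)

Deterministic bookkeeping of the powers of `N` in the PAST estimate (`0 < γ ≤ 1/15`, `0 < σ < 1/2`,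
`ε_N = hsDiameter σ N = σ (N+1)^{-1/3}`, line window `Δℓ_N = (N+1)^{-1/3} log(N+2)`):

* the `L¹`-Lipschitz constant of the block weights is `lipK = 2√3 |B₁| C (N+1)^{γ}` (`lipK_eq`), so the
  FLIGHT term `lipK · Δℓ_N → 0` (`tendsto_lipK_mul_lineWindow`, as `γ < 1/3`) and the HAND-OVER term
  `lipK · ε_N · (N+1)^{19/15} ≤ 2√3 |B₁| C σ (N+1)` (`lipK_mul_hsDiameter_mul_le`, as `γ ≤ 1/15`) — the
  exponent `19/15 = 1 + 4/15` of `FewStepsOn` is exactly what the hand-overs across `ε_N` afford;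
* the smallness conditions `(N+1)^{-γ} < 1/2`, `(N+1)^{-γ} + ε_N/2 < 1/2` hold eventually
  (`eventually_small_radius`);
* the HARD-CORE DENSITY CAP in uniform form: on the hard-sphere domain the block weights of an admissible
  kernel family have total `Σ_i w_i(s, x) ≤ 27 C σ⁻³ (N+1)` (`sum_wgt_le_uniform`, from
  `PastDamping.sum_wgt_le`), i.e. `ρ̄ ≤ 27 C/σ³`.
-/

namespace Summit.AtomisticToContinuum.HydrodynamicLimit.Theorems.ContactSourceDuhamel.TimeLocal
namespace PastDamping

open scoped BigOperators Topology Classical MeasureTheory ENNReal InnerProductSpace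
open Filter Set MeasureTheory Asymptotics
open Literature.Analysis.FluidPDE
open Literature.MathematicalPhysics.KineticTheory (hsDiameter hsDiameter_pos hsDiameter_le)

noncomputable section

variable {σ : ℝ} {N : ℕ}

/-! ## Powers of `N + 1` -/

/-- `0 < N + 1` as a real number. -/
theorem natSucc_pos (N : ℕ) : (0 : ℝ) < (N : ℝ) + 1 := by positivity

/-- The cast `((N + 1 : ℕ) : ℝ)` is `(N : ℝ) + 1`. -/
theorem cast_succ_eq (N : ℕ) : ((N + 1 : ℕ) : ℝ) = (N : ℝ) + 1 := by push_cast; ring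

/-- `lipK = 2√3 |B₁| C (N+1)^{γ}`. -/
theorem lipK_eq (C γ : ℝ) (N : ℕ) :
    lipK C γ N = 2 * Real.sqrt 3 * ballVol * C * ((N : ℝ) + 1) ^ γ := by
  unfold lipK
  have hN := natSucc_pos N
  have h3 : (((N : ℝ) + 1) ^ (-γ)) ^ 3 = ((N : ℝ) + 1) ^ (-(3 * γ)) := by
    rw [← Real.rpow_natCast, ← Real.rpow_mul hN.le]
    congr 1; push_cast; ring
  have hprod : ((N : ℝ) + 1) ^ (-(3 * γ)) * ((N : ℝ) + 1) ^ (4 * γ) = ((N : ℝ) + 1) ^ γ := by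
    rw [← Real.rpow_add hN]; congr 1; ring
  rw [h3]
  calc 2 * (((N : ℝ) + 1) ^ (-(3 * γ)) * ballVol) * (Real.sqrt 3 * (C * ((N : ℝ) + 1) ^ (4 * γ)))
      = 2 * Real.sqrt 3 * ballVol * C * (((N : ℝ) + 1) ^ (-(3 * γ)) * ((N : ℝ) + 1) ^ (4 * γ)) := by
        ring
    _ = _ := by rw [hprod]

/-- **The flight scale**: `lipK · Δℓ_N → 0` (`γ < 1/3`; `Δℓ_N (N+1)^{γ} = log(N+2)/(N+1)^{1/3−γ}`). -/
theorem tendsto_lipK_mul_lineWindow (C : ℝ) {γ : ℝ} (hγ : γ < 1 / 3) :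
    Tendsto (fun N : ℕ => lipK C γ N * Δℓ N) atTop (𝓝 0) := by
  -- `Δℓ_N (N+1)^γ ≤ (log 2 + log (N+1)) / (N+1)^{1/3 − γ} → 0`
  have hx : Tendsto (fun N : ℕ => (N : ℝ) + 1) atTop atTop :=
    tendsto_atTop_add_const_right _ _ tendsto_natCast_atTop_atTop
  set a : ℝ := 1 / 3 - γ with ha
  have ha0 : 0 < a := by rw [ha]; linarith
  have hpow : Tendsto (fun N : ℕ => ((N : ℝ) + 1) ^ a) atTop atTop := (tendsto_rpow_atTop ha0).comp hx
  have h1 : Tendsto (fun N : ℕ => Real.log ((N : ℝ) + 1) / ((N : ℝ) + 1) ^ a) atTop (𝓝 0) :=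
    ((isLittleO_log_rpow_atTop ha0).comp_tendsto hx).tendsto_div_nhds_zero
  have h2 : Tendsto (fun N : ℕ => Real.log 2 / ((N : ℝ) + 1) ^ a) atTop (𝓝 0) :=
    hpow.const_div_atTop _
  have hsum : Tendsto (fun N : ℕ => (2 * Real.sqrt 3 * ballVol * C) *
      (Real.log 2 / ((N : ℝ) + 1) ^ a + Real.log ((N : ℝ) + 1) / ((N : ℝ) + 1) ^ a)) atTop (𝓝 0) := by
    simpa using (h2.add h1).const_mul (2 * Real.sqrt 3 * ballVol * C)
  have hkey : ∀ N : ℕ, lipK C γ N * Δℓ N = (2 * Real.sqrt 3 * ballVol * C) *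
      (Real.log ((N : ℝ) + 2) / ((N : ℝ) + 1) ^ a) := by
    intro N
    have hN := natSucc_pos N
    rw [lipK_eq, Δℓ]
    have hΔ : ((N : ℝ) + 1) ^ γ * (((N : ℝ) + 1) ^ (-(1 : ℝ) / 3)) = (((N : ℝ) + 1) ^ a)⁻¹ := by
      rw [← Real.rpow_add hN, ← Real.rpow_neg hN.le]; congr 1; rw [ha]; ring
    calc 2 * Real.sqrt 3 * ballVol * C * ((N : ℝ) + 1) ^ γ *
          (((N : ℝ) + 1) ^ (-(1 : ℝ) / 3) * Real.log ((N : ℝ) + 2))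
        = 2 * Real.sqrt 3 * ballVol * C * ((((N : ℝ) + 1) ^ γ * ((N : ℝ) + 1) ^ (-(1 : ℝ) / 3)) *
            Real.log ((N : ℝ) + 2)) := by ring
      _ = _ := by rw [hΔ, inv_mul_eq_div]
  -- squeeze in absolute value
  rw [tendsto_zero_iff_norm_tendsto_zero]
  have hsum' : Tendsto (fun N : ℕ => |2 * Real.sqrt 3 * ballVol * C| *
      (Real.log 2 / ((N : ℝ) + 1) ^ a + Real.log ((N : ℝ) + 1) / ((N : ℝ) + 1) ^ a)) atTop (𝓝 0) := by
    simpa using (h2.add h1).const_mul (|2 * Real.sqrt 3 * ballVol * C|)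
  refine squeeze_zero (fun N => norm_nonneg _) (fun N => ?_) hsum'
  have hN := natSucc_pos N
  have hp : 0 < ((N : ℝ) + 1) ^ a := Real.rpow_pos_of_pos hN _
  have hlog : Real.log ((N : ℝ) + 2) ≤ Real.log 2 + Real.log ((N : ℝ) + 1) := by
    rw [← Real.log_mul (by norm_num) hN.ne']
    exact Real.log_le_log (by positivity) (by linarith)
  have hlog0 : 0 ≤ Real.log ((N : ℝ) + 2) := Real.log_nonneg (by linarith)
  rw [hkey, Real.norm_eq_abs, abs_mul, abs_of_nonneg (div_nonneg hlog0 hp.le), ← add_div]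
  exact mul_le_mul_of_nonneg_left (div_le_div_of_nonneg_right hlog hp.le) (abs_nonneg _)

/-- **The hand-over scale**: `lipK · ε_N · (N+1)^{19/15} ≤ 2√3 |B₁| C σ (N+1)` for `γ ≤ 1/15`, `C ≥ 0`,
`σ ≥ 0` — the exponent of `FewStepsOn` is what the hand-overs across the contact distance afford. -/
theorem lipK_mul_hsDiameter_mul_le {C γ σ : ℝ} (hC : 0 ≤ C) (hσ : 0 ≤ σ) (hγ : γ ≤ 1 / 15) (N : ℕ) :
    lipK C γ N * hsDiameter σ N * ((N + 1 : ℕ) : ℝ) ^ ((19 : ℝ) / 15) ≤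
      2 * Real.sqrt 3 * ballVol * C * σ * ((N + 1 : ℕ) : ℝ) := by
  have hN := natSucc_pos N
  rw [lipK_eq, hsDiameter, cast_succ_eq]
  have hexp : ((N : ℝ) + 1) ^ γ * ((N : ℝ) + 1) ^ (-(1 / 3 : ℝ)) * ((N : ℝ) + 1) ^ ((19 : ℝ) / 15) =
      ((N : ℝ) + 1) ^ (γ - 1 / 15) * ((N : ℝ) + 1) := by
    rw [← Real.rpow_add hN, ← Real.rpow_add hN, ← Real.rpow_add_one hN.ne']
    congr 1; ring
  have hle : ((N : ℝ) + 1) ^ (γ - 1 / 15) ≤ 1 :=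
    Real.rpow_le_one_of_one_le_of_nonpos (by linarith) (by linarith)
  have hK : 0 ≤ 2 * Real.sqrt 3 * ballVol * C * σ := by
    have := ballVol_nonneg; positivity
  calc 2 * Real.sqrt 3 * ballVol * C * ((N : ℝ) + 1) ^ γ * (σ * ((N : ℝ) + 1) ^ (-(1 / 3 : ℝ))) *
        ((N : ℝ) + 1) ^ ((19 : ℝ) / 15)
      = 2 * Real.sqrt 3 * ballVol * C * σ *
          (((N : ℝ) + 1) ^ γ * ((N : ℝ) + 1) ^ (-(1 / 3 : ℝ)) * ((N : ℝ) + 1) ^ ((19 : ℝ) / 15)) := by ring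
    _ = 2 * Real.sqrt 3 * ballVol * C * σ * (((N : ℝ) + 1) ^ (γ - 1 / 15) * ((N : ℝ) + 1)) := by
        rw [hexp]
    _ ≤ 2 * Real.sqrt 3 * ballVol * C * σ * (1 * ((N : ℝ) + 1)) := by
        refine mul_le_mul_of_nonneg_left (mul_le_mul_of_nonneg_right hle hN.le) hK
    _ = _ := by ring

/-! ## Eventual smallness of the radii -/

/-- `(N+1)^{-γ} → 0` for `γ > 0`. -/
theorem tendsto_rpow_neg_succ {γ : ℝ} (hγ : 0 < γ) :
    Tendsto (fun N : ℕ => ((N : ℝ) + 1) ^ (-γ)) atTop (𝓝 0) :=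
  (tendsto_rpow_neg_atTop hγ).comp (tendsto_atTop_add_const_right _ _ tendsto_natCast_atTop_atTop)

/-- `ε_N → 0`. -/
theorem tendsto_hsDiameter (σ : ℝ) : Tendsto (fun N : ℕ => hsDiameter σ N) atTop (𝓝 0) := by
  have h : Tendsto (fun N : ℕ => ((N : ℝ) + 1) ^ (-(1 / 3 : ℝ))) atTop (𝓝 0) :=
    tendsto_rpow_neg_succ (by norm_num)
  have h' : Tendsto (fun N : ℕ => σ * ((N : ℝ) + 1) ^ (-(1 / 3 : ℝ))) atTop (𝓝 0) := by
    simpa using h.const_mul σ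
  refine h'.congr fun N => ?_
  rw [hsDiameter, cast_succ_eq]

/-- **Eventually the radii are small**: `(N+1)^{-γ} < 1/2` and `(N+1)^{-γ} + ε_N/2 < 1/2`. -/
theorem eventually_small_radius {γ : ℝ} (hγ : 0 < γ) (σ : ℝ) :
    ∀ᶠ N : ℕ in atTop, ((N : ℝ) + 1) ^ (-γ) < 1 / 2 ∧ ((N : ℝ) + 1) ^ (-γ) + hsDiameter σ N / 2 < 1 / 2 := by
  have h1 := (tendsto_rpow_neg_succ hγ).eventually (gt_mem_nhds (show (0 : ℝ) < 1 / 4 by norm_num))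
  have h2 := (tendsto_hsDiameter σ).eventually (gt_mem_nhds (show (0 : ℝ) < 1 / 4 by norm_num))
  filter_upwards [h1, h2] with N hN1 hN2
  constructor <;> linarith

/-! ## The hard-core density cap, uniform form -/

/-- The packing factor: `C (N+1)^{3γ} (2 (N+1)^{-γ}/ε_N + 1)³ ≤ 27 C σ⁻³ (N+1)` for `0 < σ ≤ 1`,
`γ ≤ 1/3`, `C ≥ 0`. -/
theorem packing_le {C γ : ℝ} (hC : 0 ≤ C) (hγ : γ ≤ 1 / 3) (hσ : 0 < σ) (hσ1 : σ ≤ 1) (N : ℕ) :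
    C * ((N : ℝ) + 1) ^ (3 * γ) * (2 * ((N : ℝ) + 1) ^ (-γ) / hsDiameter σ N + 1) ^ 3 ≤
      27 * C * σ⁻¹ ^ 3 * ((N + 1 : ℕ) : ℝ) := by
  have hN := natSucc_pos N
  set b : ℝ := ((N : ℝ) + 1) ^ (1 / 3 - γ) with hb
  have hb1 : 1 ≤ b := Real.one_le_rpow (by linarith) (by linarith)
  have hratio : 2 * ((N : ℝ) + 1) ^ (-γ) / hsDiameter σ N = 2 * σ⁻¹ * b := by
    rw [hsDiameter, cast_succ_eq, hb]
    have hsplit : ((N : ℝ) + 1) ^ (1 / 3 - γ) = ((N : ℝ) + 1) ^ (-γ) * (((N : ℝ) + 1) ^ (-(1 / 3 : ℝ)))⁻¹ := by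
      rw [← Real.rpow_neg hN.le, ← Real.rpow_add hN]; congr 1; ring
    rw [hsplit]
    have hp : ((N : ℝ) + 1) ^ (-(1 / 3 : ℝ)) ≠ 0 := (Real.rpow_pos_of_pos hN _).ne'
    field_simp
  have hle : 2 * σ⁻¹ * b + 1 ≤ 3 * σ⁻¹ * b := by
    have hσinv : 1 ≤ σ⁻¹ := one_le_inv_iff₀.2 ⟨hσ, hσ1⟩
    nlinarith
  have hcube : (2 * σ⁻¹ * b + 1) ^ 3 ≤ (3 * σ⁻¹ * b) ^ 3 :=
    pow_le_pow_left₀ (by positivity) hle 3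
  have hb3 : b ^ 3 = ((N : ℝ) + 1) ^ (1 - 3 * γ) := by
    rw [hb, ← Real.rpow_natCast, ← Real.rpow_mul hN.le]; congr 1; push_cast; ring
  have hprod : ((N : ℝ) + 1) ^ (3 * γ) * ((N : ℝ) + 1) ^ (1 - 3 * γ) = (N : ℝ) + 1 := by
    rw [← Real.rpow_add hN]; norm_num
  rw [hratio, cast_succ_eq]
  calc C * ((N : ℝ) + 1) ^ (3 * γ) * (2 * σ⁻¹ * b + 1) ^ 3
      ≤ C * ((N : ℝ) + 1) ^ (3 * γ) * (3 * σ⁻¹ * b) ^ 3 :=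
        mul_le_mul_of_nonneg_left hcube (by positivity)
    _ = 27 * C * σ⁻¹ ^ 3 * (((N : ℝ) + 1) ^ (3 * γ) * b ^ 3) := by ring
    _ = 27 * C * σ⁻¹ ^ 3 * ((N : ℝ) + 1) := by rw [hb3, hprod]

/-- **The density cap, uniform form.** For `0 < σ ≤ 1`, an admissible kernel family with
`γ ≤ 1/3`, `(N+1)^{-γ} + ε_N/2 < 1/2`, and a configuration of the hard-sphere domain:
`Σ_i w_i(s, x) ≤ 27 C σ⁻³ (N+1)`. -/
theorem sum_wgt_le_uniform (hσ : 0 < σ) (hσ1 : σ ≤ 1) (Φ : Flow σ N) {γ C : ℝ} {φ : ℕ → T3 → ℝ}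
    (hadm : AdmissibleKernel γ C φ) (hγ : γ ≤ 1 / 3)
    (hhalf : ((N : ℝ) + 1) ^ (-γ) + hsDiameter σ N / 2 < 1 / 2) (s : ℝ) (z : Cfg N)
    (hz : Φ.flow s z ∈ hardSphereDomain (Torus.geometry (Fin 3)) (N + 1) (hsDiameter σ N)) (x : T3) :
    ∑ i, wgt σ N Φ φ s z x i ≤ 27 * C * σ⁻¹ ^ 3 * ((N + 1 : ℕ) : ℝ) := by
  have hC : 0 ≤ C := by
    have h := (hadm.2.1 N 0).trans (hadm.2.2.2.2.1 N 0)
    have hpow : 0 < ((N : ℝ) + 1) ^ (3 * γ) := Real.rpow_pos_of_pos (natSucc_pos N) _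
    nlinarith
  exact (sum_wgt_le Φ hadm (hsDiameter_pos hσ N) hhalf s z hz x).trans (packing_le hC hγ hσ hσ1 N)

/-- Good orbits stay in the hard-sphere domain. -/
theorem flow_mem_hardSphereDomain (Φ : Flow σ N) {z : Cfg N} (hz : z ∈ Φ.good) (s : ℝ) :
    Φ.flow s z ∈ hardSphereDomain (Torus.geometry (Fin 3)) (N + 1) (hsDiameter σ N) :=
  Φ.good_subset (Φ.mapsTo_good s hz)

/-- Registered anchor of this helper file (`lipK` unfolded: the `L¹`-Lipschitz constant is
`2√3 |B₁| C (N+1)^{γ}`, `lipK_eq`). -/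
theorem pastDamping_scales_anchor : ∀ (C γ : ℝ) (N : ℕ), 2 * ((((N : ℝ) + 1) ^ (-γ)) ^ 3 * (MeasureTheory.volume (Metric.ball (0 : V3) 1)).toReal) * (Real.sqrt 3 * (C * ((N : ℝ) + 1) ^ (4 * γ))) = 2 * Real.sqrt 3 * (MeasureTheory.volume (Metric.ball (0 : V3) 1)).toReal * C * ((N : ℝ) + 1) ^ γ :=
  fun C γ N => lipK_eq C γ N

end

end PastDamping
end Summit.AtomisticToContinuum.HydrodynamicLimit.Theorems.ContactSourceDuhamel.TimeLocal
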